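import Summits.Schanuel.Schanuel.Theorems.RootDecomp1KHyper65

/-!
# RootDecomp1KHyper — lens 6, generation 17 «BILOG STAIRCASE CELL» (BilogStair.lean edition 4 d7e974ba…, 3617 l; §K–§M) — continuation (RootDecomp1KHyper66): §M the conjugate transfer PROVED: generic twisted resultant `RZT`, `RZT_ne_zero`, `evB_RZT_eq_zero`, `coeffs_eq_zero_of_sum_pi_pow`, `zeroTransferII_holds : ZeroTransferII`, `transferII_of_innerNorm : InnerNormII → TransferII`

(lens-6 g17 `BilogStair.lean` EDITION 4, sha256 d7e974ba…2880, 3617 l, own farm rc 0 · 0 warn · 0 sorry · axioms std; §A–§J = edition 2 (ported as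
`RootDecomp1KHyper53`–`62`), §K appended in edition 3 (critic ACK STATUS L1751: additive, reshape rule respected, PORT may proceed; L1762),
§L–§M appended in edition 4 (NODE/EDITION4 L1765, statement diff 0 removed / 0 changed / 20 added); port by census-1 gen 16 in parts
`RootDecomp1KHyper63`–`66` — 63 = §K `PB` closure lemmas + `piMeasure_fin1` + `caseII_outer_core`, 64 = §K `caseII_outer`, 65 = §L `InnerNormII` /
`ZeroTransferII` (Prop defs, typed pieces) + `transferII_of_pieces` (PROVED), 66 = §M `zeroTransferII_holds` (PROVED) + `transferII_of_innerNorm`.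
PORT edits: the source's `one_le_mvlen_of_ne_zero` is the tree's `RootDecomp1KHyper03.one_le_mvlen` (deleted, two call sites re-pointed);
`le_exp_self'` / `transcendental_pi_complex` / `exists_aeval_ne_zero` private (generic one-liners with tree twins; per-part private copies);
eleven one-line docstrings added; `set_option linter.dupNamespace false` dropped; statements and proofs otherwise verbatim.
INSTRUMENTS of record, NO credit (critic L1751/L1763: TransferI/TransferII remain typed UNDECIDED; TransferII proved as typed = one theorem credit).
`--supports stmt-Schanuel-33363`; nothing here proves Schanuel; rung 0.)
-/

open Complex Polynomial IntermediateField Filter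
open scoped BigOperators

namespace Summit.Schanuel.Schanuel.Theorems.RootDecomp1KHyper

namespace HyperCell

namespace LatCell

namespace Bilog

variable {n : ℕ}
open Summit.Schanuel.Schanuel.Theorems.RootDecomp1KRelLiouvilleCell (mvPolyMeasure_one_of_polyMeasure ycoeff
  mvaeval_cons_eq_sum mvlen_ycoeff_le natDegree_finSuccEquiv_le_totalDegree norm_mvaeval_le_mvlen_mul_pow)

/-! ## §M  THE CONJUGATE TRANSFER, PROVED (`zeroTransferII_holds : ZeroTransferII`)

The generic twisted resultant `𝓡 := Res_ρ(Φ(x₁, ρ), G(x₁, u x₁ + v ρ, T)) ∈ ℤ[x₁, T, u, v]` (variables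
`0 ↦ x₁, 1 ↦ T, 2 ↦ u, 3 ↦ v`): it is `≠ 0` (specialise `v ↦ 0` at a complex non-root of
`x₁ · lc_ρ(Φ)(x₁) · G`), it vanishes at `(π, γ', p, q)` whenever `Φ(π, ρ) = 0 ∧ G(π, pπ + qρ, γ') = 0` (product
formula), so all its `x₁`-coefficients vanish at `(γ', p, q)` (`π` is transcendental over the number field `ℚ(γ')`),
and they transfer to the conjugate `γ` through the common minimal polynomial. -/

section ConjTransfer

/-- `π ∈ ℂ` is transcendental (Lindemann, tree fact `transcendental_pi_holds` transported to `ℂ`). -/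
private theorem transcendental_pi_complex : Transcendental ℚ (Real.pi : ℂ) := fun h =>
  Literature.NumberTheory.Transcendental.transcendental_pi_holds ((isAlgebraic_algebraMap_iff (A := ℂ) Complex.ofReal_injective).mp h)

/-- The coefficient ring `ℤ[x₁, T, u, v]`. -/
abbrev B4 : Type := MvPolynomial (Fin 4) ℤ

/-- `Φ(x₁, ρ)` as a polynomial in `ρ` over `ℤ[x₁, T, u, v]`. -/
noncomputable def fZT (Φ : MvPolynomial (Fin 2) ℤ) : Polynomial B4 :=
  (toPoly Φ).map (MvPolynomial.aeval (![MvPolynomial.X 0] : Fin 1 → B4)).toRingHom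

/-- `G(x₁, u x₁ + v ρ, T)` as a polynomial in `ρ` over `ℤ[x₁, T, u, v]`. -/
noncomputable def gZT (G : MvPolynomial (Fin 3) ℤ) : Polynomial B4 :=
  MvPolynomial.aeval (![Polynomial.C (MvPolynomial.X 0),
    Polynomial.C (MvPolynomial.X 2) * Polynomial.C (MvPolynomial.X 0) +
      Polynomial.C (MvPolynomial.X 3) * Polynomial.X,
    Polynomial.C (MvPolynomial.X 1)] : Fin 3 → Polynomial B4) G

/-- The generic twisted resultant `𝓡(x₁, T, u, v)`. -/
noncomputable def RZT (Φ : MvPolynomial (Fin 2) ℤ) (G : MvPolynomial (Fin 3) ℤ) : B4 :=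
  Polynomial.resultant (fZT Φ) (gZT G) (toPoly Φ).natDegree (gZT G).natDegree

/-- Evaluation `ℤ[x₁, T, u, v] → ℂ` at `(t, θ, s, w)`. -/
noncomputable def evB (t θ s w : ℂ) : B4 →+* ℂ :=
  (MvPolynomial.aeval (![t, θ, s, w] : Fin 4 → ℂ)).toRingHom

/-- `evB` on the variables. -/
theorem evB_X (t θ s w : ℂ) (i : Fin 4) : evB t θ s w (MvPolynomial.X i) = ![t, θ, s, w] i := by
  simp [evB]

/-- Mapping `fZT Φ` along `evB t θ s w` gives `Φ(t, ·)`. -/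
theorem fZT_map (Φ : MvPolynomial (Fin 2) ℤ) (t θ s w : ℂ) :
    (fZT Φ).map (evB t θ s w) = (toPoly Φ).map (MvPolynomial.aeval ![t]).toRingHom := by
  unfold fZT
  rw [Polynomial.map_map]
  congr 1
  refine MvPolynomial.ringHom_ext (fun r => by simp) (fun i => ?_)
  have hi : i = 0 := Subsingleton.elim _ _
  subst hi
  simp [evB]

/-- Mapping `gZT G` along `evB t θ s w` and evaluating at `ρ₀` gives `G(t, s t + w ρ₀, θ)`. -/
theorem gZT_map_eval (G : MvPolynomial (Fin 3) ℤ) (t θ s w ρ₀ : ℂ) :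
    ((gZT G).map (evB t θ s w)).eval ρ₀ = MvPolynomial.aeval ![t, s * t + w * ρ₀, θ] G := by
  unfold gZT
  obtain ⟨χ, hχ⟩ : ∃ χ : Polynomial B4 →+* ℂ,
      χ = (Polynomial.evalRingHom ρ₀).comp (Polynomial.mapRingHom (evB t θ s w)) := ⟨_, rfl⟩
  have h := DFunLike.congr_fun (MvPolynomial.comp_aeval (R := ℤ) χ.toIntAlgHom
    (f := (![Polynomial.C (MvPolynomial.X 0),
      Polynomial.C (MvPolynomial.X 2) * Polynomial.C (MvPolynomial.X 0) +
        Polynomial.C (MvPolynomial.X 3) * Polynomial.X,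
      Polynomial.C (MvPolynomial.X 1)] : Fin 3 → Polynomial B4))) G
  have hfun : (fun i => χ.toIntAlgHom ((![Polynomial.C (MvPolynomial.X 0),
      Polynomial.C (MvPolynomial.X 2) * Polynomial.C (MvPolynomial.X 0) +
        Polynomial.C (MvPolynomial.X 3) * Polynomial.X,
      Polynomial.C (MvPolynomial.X 1)] : Fin 3 → Polynomial B4) i)) = ![t, s * t + w * ρ₀, θ] := by
    funext i
    match i with
    | 0 => simp [hχ, evB_X]
    | 1 => simp [hχ, evB_X]
    | 2 => simp [hχ, evB_X]
  rw [hfun] at h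
  refine Eq.trans ?_ h
  rw [hχ]
  rfl

/-- Specialised resultant = product over the roots of `Φ(t, ·)` (when `lc_ρ(Φ)(t) ≠ 0`). -/
theorem evB_RZT (Φ : MvPolynomial (Fin 2) ℤ) (G : MvPolynomial (Fin 3) ℤ) (t θ s w : ℂ)
    (hlc : MvPolynomial.aeval ![t] (toPoly Φ).leadingCoeff ≠ 0) (f : ℂ[X])
    (hf : f = (toPoly Φ).map (MvPolynomial.aeval ![t]).toRingHom) :
    evB t θ s w (RZT Φ G) =
      f.leadingCoeff ^ (gZT G).natDegree *
        (f.roots.map fun r => ((gZT G).map (evB t θ s w)).eval r).prod := by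
  have hdeg : f.natDegree = (toPoly Φ).natDegree := by
    rw [hf]; exact Polynomial.natDegree_map_of_leadingCoeff_ne_zero _ hlc
  unfold RZT
  rw [← Polynomial.resultant_map_map, fZT_map, ← hf, ← hdeg]
  exact Polynomial.resultant_eq_prod_eval f _ _ Polynomial.natDegree_map_le (IsAlgClosed.splits f)

/-- `𝓡(π, γ', p, q) = 0` whenever `Φ(π, ρ) = 0` and `G(π, pπ + qρ, γ') = 0`. -/
theorem evB_RZT_eq_zero {Φ : MvPolynomial (Fin 2) ℤ} (hΦ : Φ ≠ 0) (G : MvPolynomial (Fin 3) ℤ)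
    {p q : ℚ} {ρ γ' : ℂ} (hΦρ : MvPolynomial.aeval ![(Real.pi : ℂ), ρ] Φ = 0)
    (hG : MvPolynomial.aeval ![(Real.pi : ℂ), (p : ℂ) * Real.pi + (q : ℂ) * ρ, γ'] G = 0) :
    evB (Real.pi : ℂ) γ' p q (RZT Φ G) = 0 := by
  classical
  have hlc : MvPolynomial.aeval ![(Real.pi : ℂ)] (toPoly Φ).leadingCoeff ≠ 0 :=
    aeval_pi_ne_zero (Polynomial.leadingCoeff_ne_zero.mpr (toPoly_ne_zero hΦ))
  obtain ⟨f, hf⟩ : ∃ f : ℂ[X], f = (toPoly Φ).map (MvPolynomial.aeval ![(Real.pi : ℂ)]).toRingHom :=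
    ⟨_, rfl⟩
  rw [evB_RZT Φ G _ _ _ _ hlc f hf]
  have hf0 : f ≠ 0 := by
    intro h0
    have := Polynomial.natDegree_map_of_leadingCoeff_ne_zero _ hlc
    rw [← hf, h0, Polynomial.natDegree_zero] at this
    -- then `toPoly Φ` is a constant with `lc(π) ≠ 0`, but `f = 0` forces `lc(π) = 0`
    have h2 : f.coeff 0 = MvPolynomial.aeval ![(Real.pi : ℂ)] ((toPoly Φ).coeff 0) := by
      rw [hf, Polynomial.coeff_map]; rfl
    rw [h0, Polynomial.coeff_zero] at h2
    apply hlc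
    rw [Polynomial.leadingCoeff, ← this, ← h2]
  have hρ : ρ ∈ f.roots := by
    rw [Polynomial.mem_roots hf0, Polynomial.IsRoot.def, hf, eval_map_toPoly, hΦρ]
  have h0 : (0 : ℂ) ∈ f.roots.map fun r => ((gZT G).map (evB (Real.pi : ℂ) γ' p q)).eval r :=
    Multiset.mem_map.mpr ⟨ρ, hρ, by rw [gZT_map_eval, hG]⟩
  rw [Multiset.prod_eq_zero h0, mul_zero]

/-- A non-zero integer polynomial has a complex non-root. -/
private theorem exists_aeval_ne_zero {σ : Type*} {H : MvPolynomial σ ℤ} (hH : H ≠ 0) :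
    ∃ z : σ → ℂ, MvPolynomial.aeval z H ≠ 0 := by
  by_contra h
  push Not at h
  apply hH
  apply MvPolynomial.map_injective (Int.castRingHom ℂ) Int.cast_injective
  rw [map_zero]
  apply MvPolynomial.funext
  intro z
  rw [MvPolynomial.eval_map, map_zero, ← h z, MvPolynomial.aeval_def]
  congr 1

/-- `𝓡 ≠ 0`. -/
theorem RZT_ne_zero {Φ : MvPolynomial (Fin 2) ℤ} (hΦ : Φ ≠ 0) {G : MvPolynomial (Fin 3) ℤ} (hG : G ≠ 0) :
    RZT Φ G ≠ 0 := by
  classical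
  -- a complex point `z` with `z₀ ≠ 0`, `lc_ρ(Φ)(z₀) ≠ 0`, `G(z) ≠ 0`
  obtain ⟨H, hH⟩ : ∃ H : MvPolynomial (Fin 3) ℤ, H = MvPolynomial.X 0 *
      MvPolynomial.rename (fun _ : Fin 1 => (0 : Fin 3)) (toPoly Φ).leadingCoeff * G := ⟨_, rfl⟩
  have hH0 : H ≠ 0 := by
    rw [hH]
    refine mul_ne_zero (mul_ne_zero (MvPolynomial.X_ne_zero _) ?_) hG
    exact (MvPolynomial.rename_injective _ (fun _ _ _ => Subsingleton.elim _ _)).ne_iff' (map_zero _)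
      |>.mpr (Polynomial.leadingCoeff_ne_zero.mpr (toPoly_ne_zero hΦ))
  obtain ⟨z, hz⟩ := exists_aeval_ne_zero hH0
  rw [hH, map_mul, map_mul, MvPolynomial.aeval_X, MvPolynomial.aeval_rename] at hz
  have hz0 : z 0 ≠ 0 := fun h => hz (by rw [h]; ring)
  have hlc : MvPolynomial.aeval ![z 0] (toPoly Φ).leadingCoeff ≠ 0 := by
    intro h
    apply hz
    rw [show (z ∘ fun _ : Fin 1 => (0 : Fin 3)) = ![z 0] from by funext i; simp, h]
    ring
  have hGz : MvPolynomial.aeval z G ≠ 0 := fun h => hz (by rw [h]; ring)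
  -- specialise `𝓡` at `(z₀, z₂, z₁ / z₀, 0)`
  intro hR
  obtain ⟨f, hf⟩ : ∃ f : ℂ[X], f = (toPoly Φ).map (MvPolynomial.aeval ![z 0]).toRingHom := ⟨_, rfl⟩
  have hev := evB_RZT Φ G (z 0) (z 2) (z 1 / z 0) 0 hlc f hf
  rw [hR, map_zero] at hev
  have hlcf : f.leadingCoeff ≠ 0 := by
    rw [hf, Polynomial.leadingCoeff, Polynomial.natDegree_map_of_leadingCoeff_ne_zero _ hlc,
      Polynomial.coeff_map]
    exact hlc
  have hprod : (f.roots.map fun r => ((gZT G).map (evB (z 0) (z 2) (z 1 / z 0) 0)).eval r).prod ≠ 0 := by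
    rw [Ne, Multiset.prod_eq_zero_iff, Multiset.mem_map]
    rintro ⟨r, -, hr⟩
    rw [gZT_map_eval, zero_mul, add_zero, div_mul_cancel₀ _ hz0] at hr
    have hzv : (![z 0, z 1, z 2] : Fin 3 → ℂ) = z := by
      funext i
      match i with
      | 0 => rfl
      | 1 => rfl
      | 2 => rfl
    rw [hzv] at hr
    exact hGz hr
  exact mul_ne_zero (pow_ne_zero _ hlcf) hprod hev.symm

/-- `π` is transcendental over a number field: a vanishing `Σ_k c_k(γ', p, q) π^k` with `γ'` algebraic and
`c_k ∈ ℤ[T, u, v]` has all `c_k(γ', p, q) = 0`. -/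
theorem coeffs_eq_zero_of_sum_pi_pow {γ' : ℂ} (hγ : IsIntegral ℚ γ') (p q : ℚ) {K : ℕ}
    (c : ℕ → MvPolynomial (Fin 3) ℤ)
    (h : ∑ k ∈ Finset.range (K + 1),
      MvPolynomial.aeval ![γ', (p : ℂ), (q : ℂ)] (c k) * (Real.pi : ℂ) ^ k = 0) :
    ∀ k ∈ Finset.range (K + 1), MvPolynomial.aeval ![γ', (p : ℂ), (q : ℂ)] (c k) = 0 := by
  classical
  -- the number field `L = ℚ(γ')`
  obtain ⟨L, hL⟩ : ∃ L : IntermediateField ℚ ℂ, L = IntermediateField.adjoin ℚ {γ'} := ⟨_, rfl⟩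
  haveI : FiniteDimensional ℚ L := by rw [hL]; exact IntermediateField.adjoin.finiteDimensional hγ
  haveI : Algebra.IsIntegral ℚ L := Algebra.IsIntegral.of_finite ℚ L
  have hγmem : γ' ∈ L := by rw [hL]; exact IntermediateField.mem_adjoin_simple_self ℚ γ'
  obtain ⟨v, hv⟩ : ∃ v : Fin 3 → L, v = ![⟨γ', hγmem⟩, algebraMap ℚ L p, algebraMap ℚ L q] := ⟨_, rfl⟩
  have hcoe : ∀ Q : MvPolynomial (Fin 3) ℤ,
      ((MvPolynomial.aeval v Q : L) : ℂ) = MvPolynomial.aeval ![γ', (p : ℂ), (q : ℂ)] Q := by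
    intro Q
    have h1 := DFunLike.congr_fun (MvPolynomial.comp_aeval (R := ℤ)
      ((algebraMap L ℂ : L →+* ℂ).toIntAlgHom) (f := v)) Q
    have hfun : (fun i => (algebraMap L ℂ : L →+* ℂ).toIntAlgHom (v i)) = ![γ', (p : ℂ), (q : ℂ)] := by
      funext i
      rw [hv]
      match i with
      | 0 => rfl
      | 1 => simp
      | 2 => simp
    rw [hfun] at h1
    rw [← h1]
    rfl
  -- `π` is transcendental over `L`
  have hπL : Transcendental L (Real.pi : ℂ) := by
    intro hal
    have hint : IsIntegral L (Real.pi : ℂ) := isAlgebraic_iff_isIntegral.mp hal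
    have : IsIntegral ℚ (Real.pi : ℂ) := isIntegral_trans _ hint
    exact transcendental_pi_complex (isAlgebraic_iff_isIntegral.mpr this)
  -- the polynomial `Σ_k C(c_k(v)) X^k ∈ L[X]` vanishes at `π`, hence is `0`
  obtain ⟨P₀, hP₀⟩ : ∃ P₀ : Polynomial L, P₀ = ∑ k ∈ Finset.range (K + 1),
      Polynomial.C (MvPolynomial.aeval v (c k)) * Polynomial.X ^ k := ⟨_, rfl⟩
  have hP₀π : Polynomial.aeval (Real.pi : ℂ) P₀ = 0 := by
    rw [← h, hP₀, map_sum]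
    refine Finset.sum_congr rfl fun k _ => ?_
    rw [map_mul, map_pow, Polynomial.aeval_C, Polynomial.aeval_X, ← hcoe]
    rfl
  have hP₀0 : P₀ = 0 := (transcendental_iff_injective.mp hπL) (by rw [hP₀π, map_zero])
  intro k hk
  have hcoef : P₀.coeff k = MvPolynomial.aeval v (c k) := by
    rw [hP₀, Polynomial.finsetSum_coeff]
    simp only [Polynomial.coeff_C_mul_X_pow]
    rw [Finset.sum_ite_eq, if_pos hk]
  rw [hP₀0, Polynomial.coeff_zero] at hcoef
  rw [← hcoe, ← hcoef]
  rfl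

/-- **The conjugate transfer holds.** -/
theorem zeroTransferII_holds : ZeroTransferII := by
  classical
  intro Φ hΦ G hG
  obtain ⟨R, hRdef⟩ : ∃ R : B4, R = RZT Φ G := ⟨_, rfl⟩
  have hR : R ≠ 0 := by rw [hRdef]; exact RZT_ne_zero hΦ hG
  obtain ⟨K, hK⟩ : ∃ K : ℕ, K = (MvPolynomial.finSuccEquiv ℤ 3 R).natDegree := ⟨_, rfl⟩
  refine ⟨ycoeff R K, ?_, ?_⟩
  · have h1 : MvPolynomial.finSuccEquiv ℤ 3 R ≠ 0 := (EmbeddingLike.map_ne_zero_iff).mpr hR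
    rw [hK]
    exact Polynomial.leadingCoeff_ne_zero.mpr h1
  · intro p q ρ γ γ' hγ hconj hΦρ hGγ'
    have hγ' : IsIntegral ℚ γ' := ⟨minpoly ℚ γ, minpoly.monic hγ, hconj.aeval_eq_zero⟩
    -- `𝓡(π, γ', p, q) = 0`, expanded along `x₁`
    have hev : evB (Real.pi : ℂ) γ' p q R = 0 := by rw [hRdef]; exact evB_RZT_eq_zero hΦ G hΦρ hGγ'
    have hsum := mvaeval_cons_eq_sum R (![γ', (p : ℂ), (q : ℂ)]) (Real.pi : ℂ) (K := K) (by rw [hK])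
    have hcons : (Fin.cons (Real.pi : ℂ) (![γ', (p : ℂ), (q : ℂ)]) : Fin 4 → ℂ) =
        ![(Real.pi : ℂ), γ', (p : ℂ), (q : ℂ)] := rfl
    rw [hcons] at hsum
    have hev' : MvPolynomial.aeval ![(Real.pi : ℂ), γ', (p : ℂ), (q : ℂ)] R = 0 := hev
    rw [hsum] at hev'
    have hzero := coeffs_eq_zero_of_sum_pi_pow hγ' p q (fun k => ycoeff R k) hev' K
      (Finset.self_mem_range_succ K)
    -- transfer from `γ'` to `γ` through the common minimal polynomial
    have h1 : Polynomial.aeval γ' (specT (ycoeff R K) p q) = 0 := by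
      rw [aeval_specT]; simpa using hzero
    have h2 : minpoly ℚ γ ∣ specT (ycoeff R K) p q := by
      rw [show minpoly ℚ γ = minpoly ℚ γ' from hconj]; exact minpoly.dvd ℚ γ' h1
    have h3 : Polynomial.aeval γ (specT (ycoeff R K) p q) = 0 :=
      Polynomial.aeval_eq_zero_of_dvd_aeval_eq_zero h2 (minpoly.aeval ℚ γ)
    rw [aeval_specT] at h3
    simpa using h3

end ConjTransfer

/-- **TRANSFER II ⟸ INNER NORM** (PROVED): with the conjugate transfer proved, the inner norm is the ONLY
remaining piece of (II.exp). -/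
theorem transferII_of_innerNorm (hIN : InnerNormII) : TransferII :=
  transferII_of_pieces hIN zeroTransferII_holds

end Bilog
end LatCell
end HyperCell
end Summit.Schanuel.Schanuel.Theorems.RootDecomp1KHyper
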